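import Literature.AlgebraicGeometry.HodgeTheory.BettiKunnethPieceCorrespondenceActionSurjective
import Literature.AlgebraicGeometry.HodgeTheory.ComplexOrientationCycleClassFacts
import Literature.AlgebraicGeometry.HodgeTheory.HodgeStructureOfHodgeModelTypeShift
import HarnessLib

/-!
# A `ℂ`-linear map `Hᵃ(Z;ℂ) → Hⁱ(Y;ℂ)` preserves the rational lattices iff it is the action `(crossMap t ⊗ 1)_*` of a (unique) RATIONAL class `t ∈ Hⁱ(Y;ℚ) ⊗ H^{2n−a}(Z;ℚ)` of the Künneth summand:
# `Hom_ℚ(Hᵃ(Z;ℚ), Hⁱ(Y;ℚ)) ≅ Hⁱ(Y;ℚ) ⊗ H^{2n−a}(Z;ℚ)` by the correspondence action (the rational form of «`Hᵏ(X) ⊗ Hˡ(Y) ≅ Hom(H^{2n−k}(X), Hˡ(Y))`», Voisin I §11.3.3 p. 286, Lemma 11.41)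
# (Voisin I §7.1.1, §11.3.3 Thm. 11.38, Lemma 11.41, pp. 285–287; Voisin II (10.7); Hatcher Thm. 3.2, Thm. 3.15, Cor. 3.37, Cor. 3A.6; Fulton App. B (5)–(6))

Family `hodge`, lane `lit-hodgefound` (Track 2 foundations library; Layers A1/A4), layer `Literature/AlgebraicGeometry/HodgeTheory`.  THEOREMS ONLY (no definition, no named fact, no instance;
D-0026 net debt `0`).  The seat's g30-#2/#9 identify the complex Künneth piece `Hⁱ(Y;ℂ) ⊗ Hʲ(Z;ℂ)` with `Hom_ℂ(Hᵃ(Z;ℂ), Hⁱ(Y;ℂ))` (`a + j = 2 dim Z`) under `γ ↦ γ_*`.  This file proves the RATIONAL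
form: with the complex orientations (so that Gysin maps preserve rational classes, the tree's `isRationalClass_complexGysin_complexOrientationFamily`), the action `(crossMap t ⊗ 1)_*` of a class `t`
of the rational summand `Hⁱ(Y;ℚ) ⊗ Hʲ(Z;ℚ)` maps rational classes of `Hᵃ(Z;ℂ)` to rational classes of `Hⁱ(Y;ℂ)` (§1), and conversely **every ℂ-linear `f : Hᵃ(Z;ℂ) → Hⁱ(Y;ℂ)` mapping rational
classes to rational classes is `(crossMap t ⊗ 1)_*` for a UNIQUE `t ∈ Hⁱ(Y;ℚ) ⊗ Hʲ(Z;ℚ)`** (§2).  Proof of §2: `f` descends to `f_ℚ : Hᵃ(Z;ℚ) → Hⁱ(Y;ℚ)` (the tree's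
`exists_ratLinearMap_ofRatClass_eq`); so does each `(crossMap t ⊗ 1)_*`, giving a ℚ-linear `Ψ : Hⁱ(Y;ℚ) ⊗ Hʲ(Z;ℚ) → Hom_ℚ(Hᵃ(Z;ℚ), Hⁱ(Y;ℚ))`, injective by g30-#2 (a class of the summand is
determined by its action), between spaces of the same dimension `b_i(Y) b_j(Z) = b_a(Z) b_i(Y)` (Poincaré duality `b_a = b_{2n−a}`), hence surjective; a ℂ-linear map is determined by its values on
the rational classes, which span.  §3 packages: `f` is the action of SOME rational class of `H^{2c}(Y × Z;ℚ)` iff `f` preserves the rational lattices iff `f` is the action of a unique rational class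
of the summand.

WHAT IS PROVED.
* §1 **`BettiUniverse.isRationalClass_corrAction_ofRatClass`** (`(γ ⊗ 1)_*` preserves rational classes, `γ ∈ H^{2c}(Y × Z;ℚ)`, complex orientations), `BettiUniverse.span_range_ofRatClass_eq_top`
  (rational classes span `Hᵏ(X;ℂ)`, range form), **`BettiUniverse.exists_ratLinearMap_corrAction_ofRatClass_crossMap`** (the descent `Ψ₀ t` of `(crossMap t ⊗ 1)_*`).
* §2 **`BettiUniverse.exists_crossMap_corrAction_eq_of_forall_isRationalClass`**, **`BettiUniverse.existsUnique_crossMap_corrAction_eq_of_forall_isRationalClass`**,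
  **`BettiUniverse.exists_crossMap_corrAction_ofRatClass_eq_ofRatClass`** (every ℚ-linear `g : Hᵃ(Z;ℚ) → Hⁱ(Y;ℚ)` is induced by a unique `t`: `(crossMap t ⊗ 1)_*(v ⊗ 1) = g(v) ⊗ 1`).
* §3 **`BettiUniverse.exists_corrAction_ofRatClass_eq_iff_forall_isRationalClass`**, **`BettiUniverse.finrank_tensor_eq_finrank_ratLinearMap`** (`dim_ℚ (HⁱY ⊗ HʲZ) = dim_ℚ Hom_ℚ(HᵃZ, HⁱY)`).

THE PRINTS.  C. Voisin (2002) [VoisinHodgeI2002] §7.1.1; §11.3.3 Thm. 11.38, Lemma 11.41 and pp. 285–287.  C. Voisin (2003) [VoisinHodgeII2003] §10.2.2 proof of Thm. 10.17, (10.7).  A. Hatcher (2002) [HatcherAT2002]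
§3.1 Thm. 3.2, p. 198; §3.2 Thm. 3.15; §3.3 Cor. 3.37, Prop. 3.38; §3.A Cor. 3A.6.  W. Fulton (1997) [FultonYoungTableaux1997] Appendix B §B.1 (5)–(6).

THE OBJECTS (all the tree's).  `corrAction complexOrientationFamily hY hZ hab`, `BettiUniverse.crossMap`, `ofRatClass`, `IsRationalClass`, `bettiCohomology`, `complexBetti`; `exists_ratLinearMap_ofRatClass_eq`,
`isRationalClass_complexGysin_complexOrientationFamily`, `mem_span_range_ofRatClass_basis`, the seat's g30-#2 `BettiUniverse.eq_zero_of_corrAction_crossMap_eq_zero`, `BettiUniverse.corrAction_crossMap_injective`.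

DEVIATIONS / SCOPE.  Complex orientations only in the rationality statements (a general orientation family rescales the Gysin maps by non-zero complex scalars).  No Hodge-structure statement
(Lemma 11.41 proper: Hodge classes ↔ morphisms of Hodge structures) — this is its rational-lattice layer.  No definitions.

## References
* [VoisinHodgeI2002] C. Voisin, *Hodge Theory and Complex Algebraic Geometry I* (2002) — §7.1.1; §11.3.3 Thm. 11.38, Lemma 11.41, pp. 285–287.
* [VoisinHodgeII2003] C. Voisin, *Hodge Theory and Complex Algebraic Geometry II* (2003) — §10.2.2 proof of Thm. 10.17 (10.7).
* [HatcherAT2002] A. Hatcher, *Algebraic Topology* (2002) — §3.1 Thm. 3.2, p. 198; §3.2 Thm. 3.15; §3.3 Cor. 3.37, Prop. 3.38; §3.A Cor. 3A.6.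
* [FultonYoungTableaux1997] W. Fulton, *Young Tableaux* (1997) — Appendix B §B.1 (5)–(6).

## Provenance
Lane `lit-hodgefound` (Hodge path, Track 2), prover seat `lit-hodgefound-p29` (generation 30), self-proposed row g30-#13 (rational-lattice layer of the carrier identification behind Lemma 11.41;
companion of g30-#2/#9/#11).
-/

noncomputable section

open scoped TensorProduct
open CategoryTheory MonoidalCategory CartesianMonoidalCategory Module Finset
open Literature.AlgebraicTopology.SingularHomology
open Literature.Geometry.Kaehler

namespace Literature.AlgebraicGeometry.HodgeTheory

open Literature.AlgebraicGeometry.Motives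
open Literature.AlgebraicGeometry.Motives.HodgeStructure

variable {m n : ℕ} {X Y Z : SchemeOver ℂ}

/-! ### §0 Plumbing -/

/-- `(q • a) ⊗ 1 = q • (a ⊗ 1)` for the lattice map `Hᵏ(T;ℚ) → Hᵏ(T;ℂ)` (private copy of a file-local tree lemma). [cite: HatcherAT2002, §3.1 p. 198] -/
private theorem ofRatClass_rat_smul₃ {T : Type} [TopologicalSpace T] {k : ℕ} (q : ℚ) (a : singularCohomology ℚ ℚ T k) :
    ofRatClass T k (q • a) = (q : ℂ) • ofRatClass T k a := by
  rw [ofRatClass, coeffClass_smul, smul_coeffClass]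
  refine coeffClass_congr (fun x ↦ ?_) a
  simp

/-! ### §1 Actions of rational classes preserve the rational lattices -/

/-- **`(γ ⊗ 1)_*` maps rational classes to rational classes** for `γ ∈ H^{2c}(Y × Z;ℚ)` (complex orientations: `pr_Z^*`, `∪ (γ ⊗ 1)` and the Gysin morphism `pr_{Y*}` preserve rational classes).
[cite: VoisinHodgeI2002, §7.1.1, §11.1.2] [cite: VoisinHodgeII2003, §10.2.2 (10.7)] -/
theorem BettiUniverse.isRationalClass_corrAction_ofRatClass (hY : IsSmoothProjective m Y) (hZ : IsSmoothProjective n Z) {c i a : ℕ} (hab : a + 2 * c = i + 2 * n)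
    (γ : bettiCohomology (Y ⊗ Z) (2 * c)) {u : complexBetti Z a} (hu : IsRationalClass u) :
    IsRationalClass (corrAction complexOrientationFamily hY hZ hab (ofRatClass (ComplexPoints (Y ⊗ Z)) (2 * c) γ) u) := by
  rw [corrAction_apply]
  exact isRationalClass_complexGysin_complexOrientationFamily (hY.tensor_holds hZ) hY (fst Y Z) _ ((hu.map _).cup rfl (isRationalClass_ofRatClass γ))

/-- **The rational classes span `Hᵏ(X;ℂ)` over `ℂ`** (range form of the tree's `span_isRationalClass_eq_top_of_isSmoothProjective_holds`). [cite: VoisinHodgeI2002, §7.1.1] [cite: HatcherAT2002, §3.A Cor. 3A.6] -/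
theorem BettiUniverse.span_range_ofRatClass_eq_top (hX : IsSmoothProjective n X) (k : ℕ) :
    Submodule.span ℂ (Set.range (ofRatClass (ComplexPoints X) k)) = ⊤ := by
  classical
  haveI := BettiUniverse.finite hX k
  refine eq_top_iff.2 fun y _ ↦ Submodule.span_mono ?_ (mem_span_range_ofRatClass_basis hX (Module.finBasis ℚ (bettiCohomology X k)) (y := y))
  rintro _ ⟨p, rfl⟩
  exact ⟨_, rfl⟩

/-- **The action of a class of the rational summand descends to the rational lattices**: for `t ∈ Hⁱ(Y;ℚ) ⊗ Hʲ(Z;ℚ)` there is a (unique) ℚ-linear `g : Hᵃ(Z;ℚ) → Hⁱ(Y;ℚ)` with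
`(crossMap t ⊗ 1)_*(v ⊗ 1) = g(v) ⊗ 1`. [cite: VoisinHodgeI2002, §7.1.1, §11.3.3 p. 286] -/
theorem BettiUniverse.exists_ratLinearMap_corrAction_ofRatClass_crossMap (hY : IsSmoothProjective m Y) (hZ : IsSmoothProjective n Z) {c i j a : ℕ} (hij : i + j = 2 * c) (hab : a + 2 * c = i + 2 * n)
    (t : bettiCohomology Y i ⊗[ℚ] bettiCohomology Z j) :
    ∃ g : bettiCohomology Z a →ₗ[ℚ] bettiCohomology Y i,
      ∀ v, ofRatClass (ComplexPoints Y) i (g v) = corrAction complexOrientationFamily hY hZ hab (ofRatClass (ComplexPoints (Y ⊗ Z)) (2 * c) (BettiUniverse.crossMap Y Z hij t)) (ofRatClass (ComplexPoints Z) a v) :=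
  exists_ratLinearMap_ofRatClass_eq _ fun _ hu ↦ BettiUniverse.isRationalClass_corrAction_ofRatClass hY hZ hab _ hu

/-! ### §2 Lattice-preserving maps are actions of rational classes of the summand -/

/-- **Every ℚ-linear `g : Hᵃ(Z;ℚ) → Hⁱ(Y;ℚ)` is induced by a UNIQUE class `t` of the rational summand `Hⁱ(Y;ℚ) ⊗ Hʲ(Z;ℚ)`** (`a + j = 2 dim Z`): `(crossMap t ⊗ 1)_*(v ⊗ 1) = g(v) ⊗ 1` for all `v`.  The descent
`t ↦ g_t` is ℚ-linear and injective (g30-#2) between spaces of equal dimension `b_i(Y) b_j(Z) = b_a(Z) b_i(Y)`. [cite: VoisinHodgeI2002, §11.3.3 Thm. 11.38, Lemma 11.41 and pp. 285–287]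
[cite: HatcherAT2002, §3.3 Cor. 3.37 and Prop. 3.38] -/
theorem BettiUniverse.exists_crossMap_corrAction_ofRatClass_eq_ofRatClass (hY : IsSmoothProjective m Y) (hZ : IsSmoothProjective n Z) {c i j a : ℕ} (hij : i + j = 2 * c) (haj : a + j = 2 * n)
    (hab : a + 2 * c = i + 2 * n) (g : bettiCohomology Z a →ₗ[ℚ] bettiCohomology Y i) :
    ∃! t : bettiCohomology Y i ⊗[ℚ] bettiCohomology Z j,
      ∀ v, corrAction complexOrientationFamily hY hZ hab (ofRatClass (ComplexPoints (Y ⊗ Z)) (2 * c) (BettiUniverse.crossMap Y Z hij t)) (ofRatClass (ComplexPoints Z) a v) =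
        ofRatClass (ComplexPoints Y) i (g v) := by
  classical
  haveI := BettiUniverse.finite hY i
  haveI := BettiUniverse.finite hZ j
  haveI := BettiUniverse.finite hZ a
  -- the descent `Ψ₀ t` of the action of `t`
  choose Ψ₀ hΨ₀ using BettiUniverse.exists_ratLinearMap_corrAction_ofRatClass_crossMap hY hZ hij hab (a := a)
  -- it is ℚ-linear in `t`
  let Ψ : (bettiCohomology Y i ⊗[ℚ] bettiCohomology Z j) →ₗ[ℚ] (bettiCohomology Z a →ₗ[ℚ] bettiCohomology Y i) :=
    { toFun := Ψ₀
      map_add' := fun t t' ↦ by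
        refine LinearMap.ext fun v ↦ ofRatClass_injective (Y := ComplexPoints Y) i ?_
        rw [LinearMap.add_apply, map_add, hΨ₀, hΨ₀, hΨ₀, map_add, map_add, map_add, LinearMap.add_apply]
      map_smul' := fun q t ↦ by
        refine LinearMap.ext fun v ↦ ofRatClass_injective (Y := ComplexPoints Y) i ?_
        rw [RingHom.id_apply, LinearMap.smul_apply, ofRatClass_rat_smul₃, hΨ₀, hΨ₀, map_smul, ofRatClass_rat_smul₃, map_smul, LinearMap.smul_apply] }
  have hΨ : ∀ t, Ψ t = Ψ₀ t := fun _ ↦ rfl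
  -- injective: the action determines the class (g30-#2)
  have hinj : Function.Injective Ψ := by
    rw [← LinearMap.ker_eq_bot, LinearMap.ker_eq_bot']
    intro t ht
    refine BettiUniverse.eq_zero_of_corrAction_crossMap_eq_zero complexOrientationFamily hY hZ hij haj hab ?_
    refine LinearMap.ext_on_range (BettiUniverse.span_range_ofRatClass_eq_top hZ a) fun v ↦ ?_
    rw [← hΨ₀ t v, ← hΨ t, ht, LinearMap.zero_apply, map_zero, LinearMap.zero_apply]
  -- equal dimensions, hence surjective
  have hdim : Module.finrank ℚ (bettiCohomology Y i ⊗[ℚ] bettiCohomology Z j) = Module.finrank ℚ (bettiCohomology Z a →ₗ[ℚ] bettiCohomology Y i) := by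
    rw [Module.finrank_tensorProduct, Module.finrank_linearMap, BettiUniverse.finrank_bettiCohomology_eq_of_add_eq hZ haj, mul_comm]
  obtain ⟨t, ht⟩ := (LinearMap.injective_iff_surjective_of_finrank_eq_finrank hdim).1 hinj g
  refine ⟨t, fun v ↦ by rw [← hΨ₀ t v, ← hΨ t, ht], fun t' ht' ↦ hinj ?_⟩
  rw [ht]
  refine LinearMap.ext fun v ↦ ofRatClass_injective (Y := ComplexPoints Y) i ?_
  rw [hΨ t', hΨ₀ t' v, ht' v]

/-- **A ℂ-linear `f : Hᵃ(Z;ℂ) → Hⁱ(Y;ℂ)` that maps rational classes to rational classes is `(crossMap t ⊗ 1)_*` for some `t ∈ Hⁱ(Y;ℚ) ⊗ Hʲ(Z;ℚ)`** (`a + j = 2 dim Z`; complex orientations).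
[cite: VoisinHodgeI2002, §7.1.1, §11.3.3 Lemma 11.41 and p. 286] [cite: HatcherAT2002, §3.3 Prop. 3.38 and §3.A Cor. 3A.6] -/
theorem BettiUniverse.exists_crossMap_corrAction_eq_of_forall_isRationalClass (hY : IsSmoothProjective m Y) (hZ : IsSmoothProjective n Z) {c i j a : ℕ} (hij : i + j = 2 * c) (haj : a + j = 2 * n)
    (hab : a + 2 * c = i + 2 * n) (f : complexBetti Z a →ₗ[ℂ] complexBetti Y i) (hf : ∀ u, IsRationalClass u → IsRationalClass (f u)) :
    ∃ t : bettiCohomology Y i ⊗[ℚ] bettiCohomology Z j, corrAction complexOrientationFamily hY hZ hab (ofRatClass (ComplexPoints (Y ⊗ Z)) (2 * c) (BettiUniverse.crossMap Y Z hij t)) = f := by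
  obtain ⟨g, hg⟩ := exists_ratLinearMap_ofRatClass_eq f hf
  obtain ⟨t, ht, -⟩ := BettiUniverse.exists_crossMap_corrAction_ofRatClass_eq_ofRatClass hY hZ hij haj hab g
  refine ⟨t, LinearMap.ext_on_range (BettiUniverse.span_range_ofRatClass_eq_top hZ a) fun v ↦ ?_⟩
  rw [ht v, hg v]

/-- **… and `t` is unique** (g30-#2: a class of the summand is determined by its action). [cite: VoisinHodgeI2002, §11.3.3 Lemma 11.41 and p. 286] -/
theorem BettiUniverse.existsUnique_crossMap_corrAction_eq_of_forall_isRationalClass (hY : IsSmoothProjective m Y) (hZ : IsSmoothProjective n Z) {c i j a : ℕ} (hij : i + j = 2 * c)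
    (haj : a + j = 2 * n) (hab : a + 2 * c = i + 2 * n) (f : complexBetti Z a →ₗ[ℂ] complexBetti Y i) (hf : ∀ u, IsRationalClass u → IsRationalClass (f u)) :
    ∃! t : bettiCohomology Y i ⊗[ℚ] bettiCohomology Z j, corrAction complexOrientationFamily hY hZ hab (ofRatClass (ComplexPoints (Y ⊗ Z)) (2 * c) (BettiUniverse.crossMap Y Z hij t)) = f := by
  obtain ⟨t, ht⟩ := BettiUniverse.exists_crossMap_corrAction_eq_of_forall_isRationalClass hY hZ hij haj hab f hf
  refine ⟨t, ht, fun t' ht' ↦ BettiUniverse.corrAction_crossMap_injective complexOrientationFamily hY hZ hij haj hab ?_⟩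
  change corrAction complexOrientationFamily hY hZ hab (ofRatClass (ComplexPoints (Y ⊗ Z)) (2 * c) (BettiUniverse.crossMap Y Z hij t')) =
    corrAction complexOrientationFamily hY hZ hab (ofRatClass (ComplexPoints (Y ⊗ Z)) (2 * c) (BettiUniverse.crossMap Y Z hij t))
  rw [ht, ht']

/-! ### §3 Packaging -/

/-- **`f : Hᵃ(Z;ℂ) → Hⁱ(Y;ℂ)` is the action of a rational class of `H^{2c}(Y × Z)` iff `f` maps rational classes to rational classes** (`a + 2c = i + 2 dim Z`, `i ≤ 2c`; complex orientations): «⇒» §1, «⇐» §2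
with the summand `Hⁱ(Y;ℚ) ⊗ H^{2c−i}(Z;ℚ)`. [cite: VoisinHodgeI2002, §7.1.1, §11.3.3 Lemma 11.41 and p. 286] [cite: VoisinHodgeII2003, §10.2.2 (10.7)] -/
theorem BettiUniverse.exists_corrAction_ofRatClass_eq_iff_forall_isRationalClass (hY : IsSmoothProjective m Y) (hZ : IsSmoothProjective n Z) {c i a : ℕ} (hab : a + 2 * c = i + 2 * n) (hi : i ≤ 2 * c)
    (f : complexBetti Z a →ₗ[ℂ] complexBetti Y i) :
    (∃ γ : bettiCohomology (Y ⊗ Z) (2 * c), corrAction complexOrientationFamily hY hZ hab (ofRatClass (ComplexPoints (Y ⊗ Z)) (2 * c) γ) = f) ↔ ∀ u, IsRationalClass u → IsRationalClass (f u) := by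
  refine ⟨?_, fun hf ↦ ?_⟩
  · rintro ⟨γ, rfl⟩ u hu
    exact BettiUniverse.isRationalClass_corrAction_ofRatClass hY hZ hab γ hu
  · obtain ⟨t, ht⟩ := BettiUniverse.exists_crossMap_corrAction_eq_of_forall_isRationalClass hY hZ (show i + (2 * c - i) = 2 * c by omega) (show a + (2 * c - i) = 2 * n by omega) hab f hf
    exact ⟨_, ht⟩

/-- **`dim_ℚ (Hⁱ(Y;ℚ) ⊗ Hʲ(Z;ℚ)) = dim_ℚ Hom_ℚ(Hᵃ(Z;ℚ), Hⁱ(Y;ℚ))`** (`a + j = 2 dim Z`; Poincaré duality `b_a(Z) = b_j(Z)`) — the two sides of §2. [cite: HatcherAT2002, §3.3 Cor. 3.37] [cite: VoisinHodgeI2002, §11.3.3 p. 286] -/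
theorem BettiUniverse.finrank_tensor_eq_finrank_ratLinearMap (hY : IsSmoothProjective m Y) (hZ : IsSmoothProjective n Z) {i j a : ℕ} (haj : a + j = 2 * n) :
    Module.finrank ℚ (bettiCohomology Y i ⊗[ℚ] bettiCohomology Z j) = Module.finrank ℚ (bettiCohomology Z a →ₗ[ℚ] bettiCohomology Y i) := by
  haveI := BettiUniverse.finite hY i
  haveI := BettiUniverse.finite hZ j
  haveI := BettiUniverse.finite hZ a
  rw [Module.finrank_tensorProduct, Module.finrank_linearMap, BettiUniverse.finrank_bettiCohomology_eq_of_add_eq hZ haj, mul_comm]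

end Literature.AlgebraicGeometry.HodgeTheory

end
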